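import Summits.QuantumFields.YangMills.Theorems.BalabanUVNodesN18AtByName
import Summits.QuantumFields.YangMills.Theorems.BalabanUVNodesN18Coherence

/-!
# BalabanUVNodes ∕ node N18 = NE5 — THE «AT-RECORD» MODULE (plan word (W2)): the K4 stub `YMDAG.UVSplit.S_N18 RRec` of the route's
# tree-home module `BalabanUVNodesSpineRates` UNFOLDED, ANTITONE in the rate-record predicate, CLOSED from the node's slot for EVERY `RRec`
# carrying it, GUARDED (the bundle's functional and rate fields decide; vacuity over an empty predicate), and the node's faces AT THE RECORD

Cell `pub-ymgap`, HUMAN RULING D-0062 (Track A at full width), seat `pub-ymgap-dag-n18-a` (-a KNIT-BY-NAME), generation 4.  THEOREMS ONLY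
(no `def`, no `def … : Prop`); imports the route's K4 module `YangMills/Theorems/BalabanUVNodesSpineRates.lean` (courier dag-p2 p418381, plan
word [YMPLAN-G62-WORD-MODULES + W2]: `U3Carriers`, `RateCarriers`, `RateRecordPred`, `N18At`, `RatesAt`, `S_N18`) through this seat's
`BalabanUVNodesN18AtByName` (p419190), and the seat's `BalabanUVNodesN18Coherence` (p409135: the coupling-READING primitive-rate END face
`ne5_family_couplingReading_of_primitive_rate` over the NE5 chain's torus carriers `TwoRunTorusNE5.torusCarriers`); modifies nothing; every cited
lemma is used BY NAME.  `--supports stmt-QuantumFields-19182` (K4 = spine side).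

THE STUB.  `YMDAG.UVSplit.S_N18 RRec := ∀ F D g₀ os R, RRec F D g₀ os R → N18At R.u3`, `N18At u := ∀ b ∈ ]0, u.γ], NE5 u.EA (u.EB b) u.W u.κ u.θ u.C₅`
(`T4OutputRate.NE5` :211), over the rate-record predicate PARAMETER `RRec : RateRecordPred N` — NODE 00's later-stage «rate carriers OF RECORD»
predicate, `--informal` until its home lands (R422 (A)(P2); def-T, restate window 2026-08-30 – 09-01).  By (W2) the per-node «AT-RECORD» module IS
the node's CLOSER OF RECORD for its stub; for a K4 node there is no landed `RRec` to instance, so the refinement-generic closers are stated over EVERY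
`RRec` with the named clause:
* §1 (W2) READINGS: `s_N18_iff` (`Iff.rfl`: «at every rate-carrier bundle of record, the two-run η-rate NE5 for every member of run B's first-coupling
  family, ONE θ, ONE C₅»), `n18At_iff`, `s_N18_antitone` (closed under refinement of `RRec`), `ratesAt_n18` (K4's per-string conclusion `RatesAt D R`
  carries `N18At R.u3` as its fifth conjunct).
* §2 (W2) CLOSERS, REFINEMENT-GENERIC, from N18's SLOT = its three in-edges at the NE5 chain's torus carriers — (N10 ∕ NODE A) one-run envelopes of
  both runs' coupling-indexed one-step outputs, (rows NE2∕NE3) the primitive two-run rate `r_j ≤ C₂θ^j`, (NODE O ∕ W1) the per-member pencil bound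
  `‖E₁ b g − E₀ g‖ ≤ 2Ae^{−κ′d}∕(s₀∕r_j)` at the window scales `θ^j < s₀∕C₂`: `n18At_of_primitiveRate` (`N18Coherence.ne5_family_couplingReading_of_
  primitive_rate` BY NAME ⟹ `N18At ⟨torusCarriers N W, W′, γ, κ′, g ↦ reFunctional N W (E₀ g) g, b g ↦ reFunctional N W (E₁ b g) g, θ, 2AC₂∕s₀, …⟩`);
  **`s_N18_of_primitiveRate`** — `S_N18 RRec` for EVERY `RRec` whose bundles of record carry the slot «`R.u3` IS such a torus bundle with its three
  in-edge data»; **`s_N18_of_refines`** — `S_N18 RRec` for every `RRec` refining a predicate that has it (ONE application per later-stage home, as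
  (W2) asks of `s_N0x_of_refines₅∕₅C`); `s_N18_of_pinned` (the general pin form, `N18AtByName.s_N18_of_u3_pinned`).
* §3 (W2) GUARDS (A5 ∕ the INHABITED rider ∕ R422 at node level): `n18At_zero_pair` (INHABITED, decided: equal functionals, `C₅ = 0`);
  **`not_n18At_unit_gap`** (at the countable carriers with unread domains, run A ≡ 0, run B ≡ 1, `θ = ½`: `N18At` FAILS for EVERY `C₅` — the
  FUNCTIONAL fields of `U3Carriers` decide); `n18At_unit_gap_rate_one` (the SAME functionals at `θ = 1` satisfy the node with `C₅ = 1` — ref-B A6 in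
  the route's vocabulary: the rate letter is content, `θ < 1` must be PINNED); **`not_s_N18_of_admits`** (`S_N18 RRec` is REFUTED over any `RRec`
  admitting a bundle without N18 — R422 DEFINITION FIRST: the record must pin the two runs' functionals AND `θ`); `s_N18_of_empty` (VACUITY: over a
  predicate admitting no bundle the stub holds for free — K4's existence content sits in `S_R00x`); the inhabited-with-content rider is
  `N18AtByName.n18At_kingModel_threeFactor_torus` (King's model, `θ = L^{−γ∕2} < 1`, `κ > 0`) — cited, not restated.
* §4 THE NODE's FACES AT THE RECORD: `ne5_at_record` (the node UNFOLDED at a record's bundle: the two-run bound at every member, coupling sequence,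
  background and domain), `dressed_at_record` (at a record whose U3 bundle is the DRESSED bundle `Dom := Dom₀ ⊕ (Dom₀ × T)` of the plan's design word:
  vacuum rate ∧ per-source rates at the SAME letters, `N18AtByName.n18At_dressed_iff`); the U3 → U2 edge at the record is module 2's `N17_of_U3edge`
  (not restated).
HONEST FRAMING.  Kernel bookkeeping BY NAME + decided toys; 0 sorry; nothing of Bałaban's one-step outputs `E^{(j)}(X; g, U)` is asserted or
instantiated; NE5 is NOT IN PRINT ([Balaban1987RG1] Thm 1 p. 259: uniformity in ε only) and NOT PROVED; the slot's in-edge data (NODE O's per-run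
pencils, rows NE2∕NE3's walk-currency rate) are instanced by nobody; no `RRec` home has landed ⇒ NOTHING here is a discharge of N18 and the count does
not move.  One finite four-torus at fixed ε; NOT infinite volume, NOT OS on ℝ⁴, NOT a mass gap, NOT Clay.
-/

noncomputable section

namespace YMDAG.N18

open Literature.MathematicalPhysics.QuantumFieldTheory.Balaban1983to89
open Literature.MathematicalPhysics.QuantumFieldTheory.Balaban1983to89.T4Continuum
open Literature.MathematicalPhysics.QuantumFieldTheory.Balaban1983to89.T4OutputRate (Carriers Functional NE5)
open Literature.MathematicalPhysics.QuantumFieldTheory.Balaban1983to89.TreeLengthTorus (TDom tsys)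
open Literature.MathematicalPhysics.QuantumFieldTheory.Balaban1983to89.B13Lemma3Torus (TwoTorusStep)
open Summit.QuantumFields.BalabanUV.T4Continuum.Spine.NE5.TwoRunTorusNE5 (torusCarriers reFunctional)
open Summit.QuantumFields.YangMills.BalabanUVNodes.N18Coherence (ne5_family_couplingReading_of_primitive_rate)
open Summit.QuantumFields.YangMills.BalabanUVNodes.N18AtByName (n18At_dressed_iff s_N18_of_u3_pinned)
open YMDAG.UVSplit

variable {N : ℕ} [NeZero N]

/-! ## §1 (W2) readings: the stub unfolded, antitone in `RRec`, and its place in K4's per-string conclusion -/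

/-- **WHAT `S_N18 RRec` SAYS** (`Iff.rfl`): at every rate-carrier bundle `R` of record (every family, datum, tuned sequence, loop string), for every
member `b ∈ ]0, γ]` of run B's first-coupling family, the two-run η-rate `NE5 EA (EB b) W κ θ C₅` of the bundle's functionals with ONE `θ`, ONE `C₅`.
[folklore] -/
theorem s_N18_iff (RRec : RateRecordPred N) :
    S_N18 RRec ↔ ∀ (F : T4Family) (D : Datum F N) (g₀ : ℕ → ℝ) (os : List (ULoop F)) (R : RateCarriers N),
      RRec F D g₀ os R → ∀ b : ℝ, 0 < b → b ≤ R.u3.γ → NE5 R.u3.EA (R.u3.EB b) R.u3.W R.u3.κ R.u3.θ R.u3.C₅ :=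
  Iff.rfl

/-- `N18At u` IS the K4 family shape at the bundle (`Iff.rfl`). [folklore] -/
theorem n18At_iff (u : U3Carriers) : N18At u ↔ ∀ b : ℝ, 0 < b → b ≤ u.γ → NE5 u.EA (u.EB b) u.W u.κ u.θ u.C₅ := Iff.rfl

/-- **ANTITONE IN THE RATE-RECORD PREDICATE** [bookkeeping]: if `RRec'` refines `RRec`, then `S_N18 RRec → S_N18 RRec'` — a later-stage predicate
admitting fewer bundles closes from an earlier one by ONE application. [folklore] -/
theorem s_N18_antitone {RRec RRec' : RateRecordPred N}
    (href : ∀ (F : T4Family) (D : Datum F N) (g₀ : ℕ → ℝ) (os : List (ULoop F)) (R : RateCarriers N), RRec' F D g₀ os R → RRec F D g₀ os R)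
    (h : S_N18 RRec) : S_N18 RRec' :=
  fun F D g₀ os R hR => h F D g₀ os R (href F D g₀ os R hR)

/-- K4's per-string conclusion `RatesAt D R` carries N18 as its FIFTH conjunct (after N14, N15, N16, N17; before N22). [folklore] -/
theorem ratesAt_n18 {F : T4Family} {D : Datum F N} {R : RateCarriers N} (h : RatesAt D R) : N18At R.u3 := h.2.2.2.2.1

/-! ## §2 (W2) closers, refinement-generic: from N18's slot (its three in-edges at the NE5 chain's torus carriers), for EVERY `RRec` carrying it -/

section Slot

variable {L : ℕ} [NeZero L]

/-- **N18 AT THE TORUS BUNDLE FROM ITS SLOT** [bookkeeping]: the three in-edges at the NE5 chain's carriers `torusCarriers N W` — (N10 ∕ NODE A) the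
one-run envelopes `‖E₀ g j X φ‖, ‖E₁ b g j X φ‖ ≤ Ae^{−κ′d_j(X)}` on the spaces, (rows NE2∕NE3) the primitive rate `0 < r_j ≤ C₂θ^j`, (NODE O ∕ W1)
the per-member pencil bound `‖E₁ b g − E₀ g‖ ≤ 2Ae^{−κ′d}∕(s₀∕r_j)` at the window scales `θ^j < s₀∕C₂` — give `N18At` at the bundle with the
coupling-READING functionals, rate `θ`, constant `2AC₂∕s₀`, any NE9 ∕ read-out letters (`N18Coherence.ne5_family_couplingReading_of_primitive_rate`
BY NAME). [cite: Balaban1987RG1, (1.18) p.263; Balaban1988RG2Cluster, (2.41) p.21] -/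
theorem n18At_of_primitiveRate (Nt : ℕ → ℕ) [∀ j, NeZero (Nt j)] (W : (j : ℕ) → TwoTorusStep 4 L (Nt j)) (γ : ℝ)
    (E₀ : (ℕ → ℝ) → (j : ℕ) → TDom 4 (Nt j) → (W j).Φ → ℂ) (E₁ : ℝ → (ℕ → ℝ) → (j : ℕ) → TDom 4 (Nt j) → (W j).Φ → ℂ)
    {A κ' θ C₂ s₀ : ℝ} {r : ℕ → ℝ} (hA : 0 ≤ A) (hθ : 0 < θ) (hC₂ : 0 < C₂) (hs₀ : 0 < s₀)
    (hr : ∀ j, 0 < r j) (hrate : ∀ j, r j ≤ C₂ * θ ^ j) (W' : Set (ℕ → ℝ))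
    (hA1 : ∀ g ∈ W', ∀ (j : ℕ) (X : TDom 4 (Nt j)) (φ : (W j).Φ), φ ∈ (W j).sp2 X →
      ‖E₀ g j X φ‖ ≤ A * Real.exp (-(κ' * (tsys 4 (Nt j)).dj X)))
    (hB1 : ∀ b : ℝ, 0 < b → b ≤ γ → ∀ g ∈ W', ∀ (j : ℕ) (X : TDom 4 (Nt j)) (φ : (W j).Φ), φ ∈ (W j).sp2 X →
      ‖E₁ b g j X φ‖ ≤ A * Real.exp (-(κ' * (tsys 4 (Nt j)).dj X)))
    (hE : ∀ b : ℝ, 0 < b → b ≤ γ → ∀ g ∈ W', ∀ (j : ℕ), θ ^ j < s₀ / C₂ → ∀ (X : TDom 4 (Nt j)) (φ : (W j).Φ),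
      φ ∈ (W j).sp2 X → ‖E₁ b g j X φ - E₀ g j X φ‖ ≤ 2 * (A * Real.exp (-(κ' * (tsys 4 (Nt j)).dj X))) / (s₀ / r j))
    (Λ : ℕ → ℕ → ℝ) (C₉ ω cr ρ : ℝ) :
    N18At ⟨torusCarriers Nt W, W', γ, κ', fun g => reFunctional Nt W (E₀ g) g, fun b g => reFunctional Nt W (E₁ b g) g, θ,
      2 * A * C₂ / s₀, Λ, C₉, ω, cr, ρ⟩ :=
  ne5_family_couplingReading_of_primitive_rate Nt W γ E₀ E₁ hA hθ hC₂ hs₀ hr hrate W' hA1 hB1 hE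

end Slot

/-- **`S_N18 RRec` FOR EVERY RATE-RECORD PREDICATE WHOSE BUNDLES OF RECORD CARRY THE SLOT** [bookkeeping] — the refinement-generic closer of the
K4 stub (nothing closed over an unpinned bundle, R422): the hypothesis is ONE clause the instancing predicate can carry — «`R.u3` IS the torus bundle
of two coupling-indexed one-step output families with one-run envelopes, a primitive rate `r_j ≤ C₂θ^j` and per-member pencil bounds at the window
scales» — whose content is NODE O's per-run pencils and rows NE2∕NE3's rate instantiated on Bałaban's runs. [folklore] -/
theorem s_N18_of_primitiveRate (RRec : RateRecordPred N)
    (h : ∀ (F : T4Family) (D : Datum F N) (g₀ : ℕ → ℝ) (os : List (ULoop F)) (R : RateCarriers N), RRec F D g₀ os R →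
      ∃ (L : ℕ) (_ : NeZero L) (Nt : ℕ → ℕ) (_ : ∀ j, NeZero (Nt j)) (W : (j : ℕ) → TwoTorusStep 4 L (Nt j)) (γ : ℝ)
        (E₀ : (ℕ → ℝ) → (j : ℕ) → TDom 4 (Nt j) → (W j).Φ → ℂ) (E₁ : ℝ → (ℕ → ℝ) → (j : ℕ) → TDom 4 (Nt j) → (W j).Φ → ℂ)
        (A κ' θ C₂ s₀ : ℝ) (r : ℕ → ℝ) (W' : Set (ℕ → ℝ)) (Λ : ℕ → ℕ → ℝ) (C₉ ω cr ρ : ℝ),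
        R.u3 = ⟨torusCarriers Nt W, W', γ, κ', fun g => reFunctional Nt W (E₀ g) g, fun b g => reFunctional Nt W (E₁ b g) g, θ,
          2 * A * C₂ / s₀, Λ, C₉, ω, cr, ρ⟩ ∧
        0 ≤ A ∧ 0 < θ ∧ 0 < C₂ ∧ 0 < s₀ ∧ (∀ j, 0 < r j) ∧ (∀ j, r j ≤ C₂ * θ ^ j) ∧
        (∀ g ∈ W', ∀ (j : ℕ) (X : TDom 4 (Nt j)) (φ : (W j).Φ), φ ∈ (W j).sp2 X →
          ‖E₀ g j X φ‖ ≤ A * Real.exp (-(κ' * (tsys 4 (Nt j)).dj X))) ∧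
        (∀ b : ℝ, 0 < b → b ≤ γ → ∀ g ∈ W', ∀ (j : ℕ) (X : TDom 4 (Nt j)) (φ : (W j).Φ), φ ∈ (W j).sp2 X →
          ‖E₁ b g j X φ‖ ≤ A * Real.exp (-(κ' * (tsys 4 (Nt j)).dj X))) ∧
        (∀ b : ℝ, 0 < b → b ≤ γ → ∀ g ∈ W', ∀ (j : ℕ), θ ^ j < s₀ / C₂ → ∀ (X : TDom 4 (Nt j)) (φ : (W j).Φ),
          φ ∈ (W j).sp2 X → ‖E₁ b g j X φ - E₀ g j X φ‖ ≤ 2 * (A * Real.exp (-(κ' * (tsys 4 (Nt j)).dj X))) / (s₀ / r j))) :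
    S_N18 RRec := by
  intro F D g₀ os R hR
  obtain ⟨L, _, Nt, _, W, γ, E₀, E₁, A, κ', θ, C₂, s₀, r, W', Λ, C₉, ω, cr, ρ, hu, hA, hθ, hC₂, hs₀, hr, hrate, hA1, hB1, hE⟩ :=
    h F D g₀ os R hR
  rw [hu]
  exact n18At_of_primitiveRate Nt W γ E₀ E₁ hA hθ hC₂ hs₀ hr hrate W' hA1 hB1 hE Λ C₉ ω cr ρ

/-- **`S_N18` AT EVERY REFINEMENT OF A PREDICATE CLOSING THE NODE** [bookkeeping] — the (W2) shape «`s_N0x_of_refines…`» for K4's N18: if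
`S_N18 RRec₀` (e.g. by `s_N18_of_primitiveRate`) and `RRec` refines `RRec₀`, then `S_N18 RRec` (`s_N18_antitone`). [folklore] -/
theorem s_N18_of_refines (RRec₀ RRec : RateRecordPred N) (h₀ : S_N18 RRec₀)
    (href : ∀ (F : T4Family) (D : Datum F N) (g₀ : ℕ → ℝ) (os : List (ULoop F)) (R : RateCarriers N), RRec F D g₀ os R → RRec₀ F D g₀ os R) :
    S_N18 RRec :=
  s_N18_antitone href h₀

/-- **THE GENERAL PIN FORM** [bookkeeping]: any `RRec` pinning the U3 bundle of every record to bundles `u₀(F, D, g₀, os)` carrying `N18At` closes the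
stub (`N18AtByName.s_N18_of_u3_pinned`). [folklore] -/
theorem s_N18_of_pinned (RRec : RateRecordPred N)
    (u₀ : (F : T4Family) → Datum F N → (ℕ → ℝ) → List (ULoop F) → U3Carriers) (h : ∀ F D g₀ os, N18At (u₀ F D g₀ os))
    (hpin : ∀ (F : T4Family) (D : Datum F N) (g₀ : ℕ → ℝ) (os : List (ULoop F)) (R : RateCarriers N),
      RRec F D g₀ os R → R.u3 = u₀ F D g₀ os) :
    S_N18 RRec :=
  s_N18_of_u3_pinned RRec u₀ h hpin

/-! ## §3 (W2) guards: inhabited; the functional and rate fields decide; vacuity over an empty predicate -/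

/-- **INHABITED** [decided toy]: at ANY carriers and window, two EQUAL coupling-blind functional fields satisfy `N18At` with `C₅ = 0` (every other
letter free) — the stub's conclusion is satisfiable; the rider WITH CONTENT (`θ < 1`, `κ > 0`, non-trivial functionals) is
`N18AtByName.n18At_kingModel_threeFactor_torus`. [folklore] -/
theorem n18At_zero_pair (C : Carriers) (W : Set (ℕ → ℝ)) (E : Functional C C.BgA) (γ κ θ : ℝ) (Λ : ℕ → ℕ → ℝ)
    (C₉ ω cr ρ : ℝ) :
    N18At ⟨C, W, γ, κ, fun g U X => E g U X, fun _ g U X => E g (C.transport U) X, θ, 0, Λ, C₉, ω, cr, ρ⟩ := by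
  intro b _ _ g _ U X
  show |E g (C.transport U) X - E g (C.transport U) X| ≤ 0 * θ ^ C.scale X * Real.exp (-(κ * C.d X))
  simp

/-- **THE FUNCTIONAL FIELDS DECIDE** [decided toy]: at the countable carriers `Dom := ℕ` (creation scale = the index, tree length `0`, trivial
backgrounds), window `univ`, radius `1`, run A's functional `≡ 0` and run B's family `≡ 1`, rate `θ = ½`: `N18At` FAILS for EVERY constant `C₅` (and
every `κ` and NE9 ∕ read-out letters) — `C₅·(½)^j < 1 = |0 − 1|` at a large scale `j`. [folklore] -/
theorem not_n18At_unit_gap (κ C₅ : ℝ) (Λ : ℕ → ℕ → ℝ) (C₉ ω cr ρ : ℝ) :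
    ¬ N18At ⟨{ Dom := ℕ, scale := fun j => j, d := fun _ => 0, d_nonneg := fun _ => le_rfl, BgA := PUnit, BgB := PUnit,
                  gauge := fun _ _ => 0, gauge_nonneg := fun _ _ => le_rfl, transport := id },
               Set.univ, 1, κ, fun _ _ _ => 0, fun _ _ _ _ => 1, 1 / 2, C₅, Λ, C₉, ω, cr, ρ⟩ := by
  intro h
  -- a scale `j` with `C₅·(½)^j < 1`
  obtain ⟨j, hj⟩ : ∃ j : ℕ, C₅ * (1 / 2 : ℝ) ^ j < 1 := by
    by_cases hC : 0 < C₅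
    · obtain ⟨j, hj⟩ := exists_pow_lt_of_lt_one (inv_pos.mpr hC) (by norm_num : (1 / 2 : ℝ) < 1)
      refine ⟨j, ?_⟩
      calc C₅ * (1 / 2 : ℝ) ^ j < C₅ * C₅⁻¹ := mul_lt_mul_of_pos_left hj hC
        _ = 1 := mul_inv_cancel₀ hC.ne'
    · exact ⟨0, by simp only [pow_zero, mul_one]; linarith⟩
  have hb := h 1 one_pos le_rfl (fun _ => 0) (Set.mem_univ _) PUnit.unit j
  have hval : |(0 : ℝ) - 1| = 1 := by norm_num
  have hrhs : C₅ * (1 / 2 : ℝ) ^ j * Real.exp (-(κ * 0)) = C₅ * (1 / 2 : ℝ) ^ j := by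
    rw [mul_zero, neg_zero, Real.exp_zero, mul_one]
  have hb' : (1 : ℝ) ≤ C₅ * (1 / 2 : ℝ) ^ j := by
    have := hb
    rw [hval, hrhs] at this
    exact this
  linarith

/-- **… AND THE RATE LETTER DECIDES** (ref-B A6 in the route's vocabulary) [decided toy]: the SAME carriers and functionals at rate `θ = 1` SATISFY
`N18At` with `C₅ = 1` — one-run envelopes alone carry the node when `θ ≥ 1` (`N18End.ne5_of_decayBounds_one_le`); the content of N18 is a PINNED
`θ < 1`. [folklore] -/
theorem n18At_unit_gap_rate_one (Λ : ℕ → ℕ → ℝ) (C₉ ω cr ρ : ℝ) :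
    N18At ⟨{ Dom := ℕ, scale := fun j => j, d := fun _ => 0, d_nonneg := fun _ => le_rfl, BgA := PUnit, BgB := PUnit,
                gauge := fun _ _ => 0, gauge_nonneg := fun _ _ => le_rfl, transport := id },
             Set.univ, 1, 0, fun _ _ _ => 0, fun _ _ _ _ => 1, 1, 1, Λ, C₉, ω, cr, ρ⟩ := by
  intro b _ _ g _ U j
  show |(0 : ℝ) - 1| ≤ 1 * 1 ^ j * Real.exp (-(0 * 0))
  rw [one_pow, mul_zero, neg_zero, Real.exp_zero]
  norm_num

/-- **`S_N18` IS REFUTED OVER ANY RATE-RECORD PREDICATE ADMITTING A BUNDLE WITHOUT N18** (e.g. one whose `u3` is the unit-gap bundle at `θ = ½`):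
the stub is closable only over a predicate that PINS the two runs' functionals and the rate letter (R422 DEFINITION FIRST, here for K4's N18).
[folklore] -/
theorem not_s_N18_of_admits (RRec : RateRecordPred N)
    (h : ∃ (F : T4Family) (D : Datum F N) (g₀ : ℕ → ℝ) (os : List (ULoop F)) (R : RateCarriers N), RRec F D g₀ os R ∧ ¬ N18At R.u3) :
    ¬ S_N18 RRec := by
  rintro hS
  obtain ⟨F, D, g₀, os, R, hR, hn⟩ := h
  exact hn (hS F D g₀ os R hR)

/-- **VACUITY OVER AN EMPTY PREDICATE** [bookkeeping]: a rate-record predicate admitting NO bundle has `S_N18` for free — the reason (W2) asks for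
the inhabited rider; K4's existence content sits in `S_R00x` (bundles of record exist under the pins), not in `S_N18`. [folklore] -/
theorem s_N18_of_empty (RRec : RateRecordPred N)
    (h : ∀ (F : T4Family) (D : Datum F N) (g₀ : ℕ → ℝ) (os : List (ULoop F)) (R : RateCarriers N), ¬ RRec F D g₀ os R) :
    S_N18 RRec :=
  fun F D g₀ os R hR => absurd hR (h F D g₀ os R)

/-! ## §4 The node's faces AT THE RECORD -/

section AtRecord

variable (RRec : RateRecordPred N)

/-- **THE NODE UNFOLDED AT A RECORD's BUNDLE** [bookkeeping]: `S_N18 RRec` gives, at every bundle `R` of record, every member `b ∈ ]0, R.u3.γ]`, every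
coupling sequence `g ∈ R.u3.W`, every run-B background `U` and every domain `X`, the two-run bound
`|EA g (transport U) X − EB b g U X| ≤ C₅·θ^{scale X}·e^{−κ·d X}` with the bundle's letters — what N17 (through module 2's `n17At_of_u3` ∕
`N17_of_U3edge`) and N19's edge (`RatesAt`) read. [folklore] -/
theorem ne5_at_record (h : S_N18 RRec) {F : T4Family} {D : Datum F N} {g₀ : ℕ → ℝ} {os : List (ULoop F)} {R : RateCarriers N}
    (hR : RRec F D g₀ os R) {b : ℝ} (hb : 0 < b) (hbγ : b ≤ R.u3.γ) {g : ℕ → ℝ} (hg : g ∈ R.u3.W) (U : R.u3.C.BgB)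
    (X : R.u3.C.Dom) :
    |R.u3.EA g (R.u3.C.transport U) X - R.u3.EB b g U X| ≤ R.u3.C₅ * R.u3.θ ^ R.u3.C.scale X * Real.exp (-(R.u3.κ * R.u3.C.d X)) :=
  h F D g₀ os R hR b hb hbγ g hg U X

/-- **AT A RECORD WHOSE U3 BUNDLE IS THE DRESSED BUNDLE** (plan [YMPLAN-G61-WORD-U3-DRESSED]: `Dom := Dom₀ ⊕ (Dom₀ × T)`, same scale and tree
length, vacuum functionals on `inl`, dressed pieces on `inr`) [bookkeeping]: `S_N18 RRec` gives the VACUUM `N18At` and, for every source letter `t`,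
the dressed `N18At` at the SAME letters (`N18AtByName.n18At_dressed_iff`). [cite: Balaban1988Convergent, (2.27) p.259] -/
theorem dressed_at_record (h : S_N18 RRec) {F : T4Family} {D : Datum F N} {g₀ : ℕ → ℝ} {os : List (ULoop F)} {R : RateCarriers N}
    (hR : RRec F D g₀ os R) {C : Carriers} {T : Type} (EA : Functional C C.BgA) (EB : ℝ → Functional C C.BgB)
    (DA : T → Functional C C.BgA) (DB : T → ℝ → Functional C C.BgB) {W : Set (ℕ → ℝ)} {γ κ θ C₅ : ℝ} {Λ : ℕ → ℕ → ℝ}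
    {C₉ ω cr ρ : ℝ}
    (hu : R.u3 = ⟨{ C with
                      Dom := C.Dom ⊕ (C.Dom × T)
                      scale := Sum.elim C.scale fun p => C.scale p.1
                      d := Sum.elim C.d fun p => C.d p.1
                      d_nonneg := Sum.rec (fun X => C.d_nonneg X) fun p => C.d_nonneg p.1 },
                    W, γ, κ, (fun g U X => Sum.elim (EA g U) (fun p => DA p.2 g U p.1) X),
                    (fun b g U X => Sum.elim (EB b g U) (fun p => DB p.2 b g U p.1) X), θ, C₅, Λ, C₉, ω, cr, ρ⟩) :
    N18At ⟨C, W, γ, κ, EA, EB, θ, C₅, Λ, C₉, ω, cr, ρ⟩ ∧ ∀ t, N18At ⟨C, W, γ, κ, DA t, DB t, θ, C₅, Λ, C₉, ω, cr, ρ⟩ := by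
  have h18 := h F D g₀ os R hR
  rw [hu] at h18
  exact (n18At_dressed_iff EA EB DA DB).1 h18

end AtRecord

end YMDAG.N18

end
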